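import Literature.Analysis.FluidPDE.TsaiBootstrapTools
import Literature.Analysis.FluidPDE.TsaiGradientEstimate
import Literature.Analysis.FluidPDE.GNSOnBalls
import HarnessLib

/-!
# Tsai's bootstrap (Lemma 3.2, §3.2): polynomial growth of the local Sobolev norms of a Leray
  profile in `L^q`

Analysis/FluidPDE proofs layer for the decomposition of the named fact
`Literature.Analysis.FluidPDE.tsai1998_lemma32` (`FluidPDE/TsaiGrowthLemmas`; T.-P. Tsai, *On
Leray's self-similar solutions of the Navier–Stokes equations satisfying local energy
estimates*, Arch. Rational Mech. Anal. 143 (1998) 29–51, **Lemma 3.2**: for a weak solution `U`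
of Leray's system (1.3) with `U ∈ L^q((EuclideanSpace ℝ (Fin 3)))`, `3 ≤ q ≤ ∞`, the pressure grows at most polynomially).

## The printed argument (Tsai 1998, §3.1–§3.2, pp. 36–39) and this file

With `B = B_ρ(y₀)` and `F = aU + a(y·∇)U + (U·∇)U`, so that `νΔU − ∇P = F`, `div U = 0`:
Lemma 3.1 gives `‖∇U‖_{2,B₁} + ‖U‖_{6,B₁} = o(|y₀|^{1/2})`; then (p. 38)
`‖F‖_{3/2,B₁} ≤ C(‖U‖_{2,B₁} + |y₀|‖∇U‖_{2,B₁} + ‖U‖_{6,B₁}‖∇U‖_{2,B₁}) = o(|y₀|^{3/2})`, the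
interior estimate (3.2) gives `‖∇²U‖_{3/2,B_{1/2}} + ‖∇P‖_{3/2,B_{1/2}} = o(|y₀|^{3/2})`, Sobolev
gives `‖∇U‖_{3,B_{1/2}} + ‖P‖_{3,B_{1/2}} = o(|y₀|^{3/2})`; going back to `F`,
`‖F‖_{2,B_{1/2}} = o(|y₀|²)`, (3.2) and Sobolev again give
`‖∇²U‖_{2,B_{1/4}} + ‖∇P‖_{2,B_{1/4}} = o(|y₀|²)`, `‖∇U‖_{6,B_{1/4}} + ‖P‖_{6,B_{1/4}} = o(|y₀|²)` …

This file carries out exactly these two rounds for the tree's smooth profiles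
(`IsLerayProfile ν a U P`, `U ∈ C^∞ ∩ L^q`, `3 ≤ q ≤ ∞`), on concentric balls `B(x₀, ·)` with
the radius divided by `2` at each use of the Stokes estimate and by `3` at each use of Sobolev's
imbedding (interior GNS, `GNSOnBalls`), and with **polynomial** (`K (1 + |x₀|)^m`) in place of
`o(|y₀|^s)` bounds — which is all Lemma 3.2 needs. Inputs:

* the local pressure control `‖P − c_{x₀}‖_{L^{3/2}(B(x₀,1000R))} ≤ K_P (1 + |x₀|)`
  (`TsaiLocalPressure`, from the `L²`/`L^p` theory of the normalised pressure) — a hypothesis here,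
  for an arbitrary choice of constants `c : (EuclideanSpace ℝ (Fin 3)) → ℝ`;
* the gradient estimate (3.1) (`TsaiGradientEstimate`);
* the Stokes interior estimate (3.2), the named fact `stokes_interior_Lr_estimate`
  (`StokesInteriorEstimate`) — a hypothesis `hSt`.

Output (`IsLerayProfile.bootstrap`): polynomial bounds for `‖D²U‖_{L²(B(x₀,9R))}`,
`‖DU‖_{L⁶(B(x₀,3R))}` and `‖U‖_{L^{12}(B(x₀,R))}` (the last by GNS with `p = 12/5`, replacing
Morrey's imbedding `W^{1,6} ⊂ C^{1/2}` used in print for `osc U`). The third round of the printed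
bootstrap (`r = 6`, `osc P`) is replaced in `TsaiPressureGrowth` by a direct potential estimate.

Everything is proved; no definitions, no named facts.

## References

* T.-P. Tsai, *On Leray's self-similar solutions of the Navier–Stokes equations satisfying local
  energy estimates*, Arch. Rational Mech. Anal. 143 (1998), Lemma 3.1, §3.2 "Bootstrap", Lemma 3.2
  (pp. 36–39) [Tsai1998].
-/

noncomputable section

open MeasureTheory Set Function Filter Topology InnerProductSpace Metric
open scoped RealInnerProductSpace Laplacian ContDiff ENNReal NNReal

namespace Literature.Analysis.FluidPDE

section Bootstrap

-- nested operator types `(EuclideanSpace ℝ (Fin 3)) →L[ℝ] (EuclideanSpace ℝ (Fin 3)) →L[ℝ] (EuclideanSpace ℝ (Fin 3))`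
set_option maxSynthPendingDepth 3

variable {ν a : ℝ} {U : (EuclideanSpace ℝ (Fin 3)) → (EuclideanSpace ℝ (Fin 3))} {P : (EuclideanSpace ℝ (Fin 3)) → ℝ}

/-! ### Preliminaries: finiteness and uniform local bounds -/

/-- A continuous function is in every `L^p(B(x₀, R))`. [folklore] -/
theorem memLp_restrict_ball_of_continuous {G : Type*} [NormedAddCommGroup G] {f : (EuclideanSpace ℝ (Fin 3)) → G}
    (hf : Continuous f) (x₀ : (EuclideanSpace ℝ (Fin 3))) (R : ℝ) (p : ℝ≥0∞) :
    MemLp f p (volume.restrict (ball x₀ R)) := by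
  haveI : IsFiniteMeasure ((volume : Measure (EuclideanSpace ℝ (Fin 3))).restrict (ball x₀ R)) :=
    isFiniteMeasure_restrict.2 measure_ball_lt_top.ne
  obtain ⟨C, hC⟩ := (isCompact_closedBall x₀ R).exists_bound_of_continuousOn hf.continuousOn
  refine MemLp.of_bound hf.aestronglyMeasurable C ?_
  rw [ae_restrict_iff' measurableSet_ball]
  exact Eventually.of_forall fun x hx => hC x (ball_subset_closedBall hx)

/-- The `L^p(B(x₀, R))` norm of a continuous function is finite. [folklore] -/
theorem eLpNorm_restrict_ball_lt_top {G : Type*} [NormedAddCommGroup G] {f : (EuclideanSpace ℝ (Fin 3)) → G}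
    (hf : Continuous f) (x₀ : (EuclideanSpace ℝ (Fin 3))) (R : ℝ) (p : ℝ≥0∞) :
    eLpNorm f p (volume.restrict (ball x₀ R)) < ⊤ :=
  (memLp_restrict_ball_of_continuous hf x₀ R p).eLpNorm_lt_top

/-- The Hölder exponent `1/s − 1/q` is nonnegative for `1 ≤ s ≤ q` (with `1/∞ = 0`). [folklore] -/
theorem one_div_toReal_sub_nonneg {s q : ℝ≥0∞} (hs1 : 1 ≤ s) (hs : s ≤ q) :
    0 ≤ 1 / s.toReal - 1 / q.toReal := by
  rcases eq_or_ne q ⊤ with hq | hq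
  · rw [hq, ENNReal.toReal_top, div_zero, sub_zero]
    positivity
  · have hs' : s ≠ ⊤ := ne_top_of_le_ne_top hq hs
    have h1 : (1 : ℝ) ≤ s.toReal := by
      have := ENNReal.toReal_mono hs' hs1
      rwa [ENNReal.toReal_one] at this
    have h2 : s.toReal ≤ q.toReal := ENNReal.toReal_mono hq hs
    rw [sub_nonneg]
    exact one_div_le_one_div_of_le (by linarith) h2

/-- **Uniform local bounds from `U ∈ L^q`**: for `1 ≤ s ≤ q` there is `C` with
`‖U‖_{L^s(B(x₀,R))} ≤ C` for every centre. [folklore] -/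
theorem exists_eLpNorm_restrict_ball_le_of_memLp {G : Type*} [NormedAddCommGroup G] {U : (EuclideanSpace ℝ (Fin 3)) → G}
    (hU : Continuous U) {q : ℝ≥0∞} (hUq : MemLp U q volume) {s : ℝ≥0∞} (hs1 : 1 ≤ s) (hs : s ≤ q)
    (R : ℝ) :
    ∃ C : ℝ, 0 ≤ C ∧ ∀ x₀ : (EuclideanSpace ℝ (Fin 3)), eLpNorm U s (volume.restrict (ball x₀ R)) ≤ ENNReal.ofReal C := by
  set W : ℝ≥0∞ := eLpNorm U q volume * (volume (ball (0 : (EuclideanSpace ℝ (Fin 3))) R)) ^ (1 / s.toReal - 1 / q.toReal)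
    with hW
  have hWlt : W < ⊤ :=
    ENNReal.mul_lt_top hUq.eLpNorm_lt_top (volume_ball_rpow_lt_top R (one_div_toReal_sub_nonneg hs1 hs))
  refine ⟨W.toReal, ENNReal.toReal_nonneg, fun x₀ => ?_⟩
  rw [ENNReal.ofReal_toReal hWlt.ne]
  calc eLpNorm U s (volume.restrict (ball x₀ R))
      ≤ eLpNorm U q (volume.restrict (ball x₀ R)) *
          (volume (ball (0 : (EuclideanSpace ℝ (Fin 3))) R)) ^ (1 / s.toReal - 1 / q.toReal) :=
        eLpNorm_ball_le_mul_eLpNorm hU.aestronglyMeasurable hs x₀ R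
    _ ≤ W := by
        rw [hW]
        gcongr
        exact Measure.restrict_le_self

/-- `‖f‖_{L²(μ)} ≤ √B` when `∫ g ≤ B` for a pointwise bound `‖f‖² ≤ g` with `g` integrable and
`f ∈ L²` (via the tree's `eLpNorm_two_le_ofReal_sqrt`). [folklore] -/
theorem eLpNorm_two_le_sqrt_of_sq_le {G : Type*} [NormedAddCommGroup G] {μ : Measure (EuclideanSpace ℝ (Fin 3))}
    {f : (EuclideanSpace ℝ (Fin 3)) → G} {g : (EuclideanSpace ℝ (Fin 3)) → ℝ} (hf : MemLp f 2 μ) (hfg : ∀ x, ‖f x‖ ^ 2 ≤ g x) (hg : Integrable g μ)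
    {B : ℝ} (hB : ∫ x, g x ∂μ ≤ B) : eLpNorm f 2 μ ≤ ENNReal.ofReal (Real.sqrt B) := by
  refine eLpNorm_two_le_ofReal_sqrt hf ((integral_mono ?_ hg hfg).trans hB)
  exact (memLp_two_iff_integrable_sq_norm hf.1).1 hf

/-- **Hölder `(3/2, 3)` for a mixed integral over a closed ball inside a larger open ball**:
`∫_{B̄(x₀,r)} |f| |g| ≤ ‖f‖_{L^{3/2}(B(x₀,S))} ‖g‖_{L³(B(x₀,S))}` for `r < S` and continuous
`f`, `g` (values of the two norms as real numbers). [folklore] -/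
theorem integral_closedBall_mul_le_eLpNorm_mul {f : (EuclideanSpace ℝ (Fin 3)) → ℝ} {g : (EuclideanSpace ℝ (Fin 3)) → (EuclideanSpace ℝ (Fin 3))} (hf : Continuous f)
    (hg : Continuous g) (x₀ : (EuclideanSpace ℝ (Fin 3))) {r S : ℝ} (hrS : r < S) :
    ∫ x in closedBall x₀ r, |f x| * ‖g x‖ ≤
      (eLpNorm f (ENNReal.ofReal (3 / 2)) (volume.restrict (ball x₀ S))).toReal *
        (eLpNorm g 3 (volume.restrict (ball x₀ S))).toReal := by
  set μ := (volume : Measure (EuclideanSpace ℝ (Fin 3))).restrict (ball x₀ S) with hμ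
  -- enlarge the domain
  have hsub : closedBall x₀ r ⊆ ball x₀ S := closedBall_subset_ball hrS
  have hnn : ∀ x, 0 ≤ |f x| * ‖g x‖ := fun x => by positivity
  have hint : Integrable (fun x => |f x| * ‖g x‖) μ :=
    ((hf.abs.mul hg.norm).continuousOn.integrableOn_compact (isCompact_closedBall x₀ S)).mono_set
      ball_subset_closedBall
  have h1 : ∫ x in closedBall x₀ r, |f x| * ‖g x‖ ≤ ∫ x, |f x| * ‖g x‖ ∂μ := by
    rw [hμ]
    exact setIntegral_mono_set hint (Eventually.of_forall hnn) (Eventually.of_forall hsub)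
  -- Hölder with real exponents `3/2`, `3`
  have hpq : (3 / 2 : ℝ).HolderConjugate 3 := ⟨by norm_num, by norm_num, by norm_num⟩
  have hF : MemLp (fun x => |f x|) (ENNReal.ofReal (3 / 2)) μ :=
    memLp_restrict_ball_of_continuous hf.abs x₀ S _
  have hG : MemLp (fun x => ‖g x‖) (ENNReal.ofReal 3) μ :=
    memLp_restrict_ball_of_continuous hg.norm x₀ S _
  have h2 := integral_mul_le_Lp_mul_Lq_of_nonneg hpq (Eventually.of_forall fun x => abs_nonneg (f x))
    (Eventually.of_forall fun x => norm_nonneg (g x)) hF hG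
  refine h1.trans (h2.trans (le_of_eq ?_))
  -- identify the two factors with `eLpNorm`s
  have e1 : (eLpNorm f (ENNReal.ofReal (3 / 2)) μ).toReal = (∫ x, |f x| ^ (3 / 2 : ℝ) ∂μ) ^ (1 / (3 / 2 : ℝ)) := by
    have hm : MemLp f (ENNReal.ofReal (3 / 2)) μ := memLp_restrict_ball_of_continuous hf x₀ S _
    rw [hm.eLpNorm_eq_integral_rpow_norm (by norm_num) ENNReal.ofReal_ne_top,
      ENNReal.toReal_ofReal (by positivity), ENNReal.toReal_ofReal (by norm_num)]
    simp only [Real.norm_eq_abs, one_div]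
  have e2 : (eLpNorm g 3 μ).toReal = (∫ x, ‖g x‖ ^ (3 : ℝ) ∂μ) ^ (1 / (3 : ℝ)) := by
    have hm : MemLp g 3 μ := memLp_restrict_ball_of_continuous hg x₀ S _
    rw [hm.eLpNorm_eq_integral_rpow_norm (by norm_num) (by norm_num),
      ENNReal.toReal_ofReal (by positivity)]
    norm_num
  rw [e1, e2]
/-- Local `L¹` norms of `|U|³` from a global `L^q` bound, `3 ≤ q ≤ ∞`, uniformly in the centre.
[folklore] -/
theorem setIntegral_norm_pow_three_le_of_eLpNorm_le {U : (EuclideanSpace ℝ (Fin 3)) → (EuclideanSpace ℝ (Fin 3))} (hU : Continuous U) {q : ℝ≥0∞}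
    (hq : 3 ≤ q) {B : ℝ} (hB : 0 ≤ B) (hUq : eLpNorm U q volume ≤ ENNReal.ofReal B) (y : (EuclideanSpace ℝ (Fin 3))) (r : ℝ) :
    ∫ w in closedBall y r, ‖U w‖ ^ 3 ≤
      ((volume (closedBall (0 : (EuclideanSpace ℝ (Fin 3))) r)) ^ (1 - 1 / (q / 3).toReal)).toReal * B ^ 3 := by
  have hF : AEStronglyMeasurable (fun w => ‖U w‖ ^ 3) volume := (hU.norm.pow 3).aestronglyMeasurable
  have hq3 : 1 ≤ q / 3 := by
    rw [ENNReal.le_div_iff_mul_le (Or.inl three_ne_zero) (Or.inl ENNReal.ofNat_ne_top), one_mul]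
    exact hq
  have hnorm : eLpNorm (fun w => ‖U w‖ ^ 3) (q / 3) volume = eLpNorm U q volume ^ (3 : ℝ) := by
    have h := eLpNorm_norm_rpow U (p := q / 3) (μ := volume) (q := 3) three_pos
    have hq' : q / 3 * ENNReal.ofReal 3 = q := by
      rw [ENNReal.ofReal_ofNat, ENNReal.div_mul_cancel three_ne_zero ENNReal.ofNat_ne_top]
    rw [hq'] at h
    rw [← h]
    refine eLpNorm_congr_ae (Eventually.of_forall fun w => ?_)
    simp only [Real.rpow_ofNat]
  have hB3 : eLpNorm (fun w => ‖U w‖ ^ 3) (q / 3) volume ≤ ENNReal.ofReal (B ^ 3) := by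
    rw [hnorm]
    calc eLpNorm U q volume ^ (3 : ℝ) ≤ ENNReal.ofReal B ^ (3 : ℝ) := ENNReal.rpow_le_rpow hUq (by norm_num)
      _ = ENNReal.ofReal (B ^ 3) := by
          rw [ENNReal.ofReal_rpow_of_nonneg hB (by norm_num), Real.rpow_ofNat]
  have h := (setIntegral_norm_le_of_eLpNorm_le hF hq3 (pow_nonneg hB 3) hB3 y r).2
  refine le_trans (le_of_eq ?_) h
  refine integral_congr_ae (Eventually.of_forall fun w => ?_)
  simp only [Real.norm_eq_abs, abs_pow, abs_norm]

/-- `ENNReal.ofReal (3/2) = 3/2` and its real value. [folklore] -/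
theorem ofReal_three_halves : ENNReal.ofReal (3 / 2) = (3 / 2 : ℝ≥0∞) := by
  rw [ENNReal.ofReal_div_of_pos two_pos, ENNReal.ofReal_ofNat, ENNReal.ofReal_ofNat]

/-! ### Step 1 (Lemma 3.1): `‖DU‖_{L²(B(x₀, 324R))} ≤ K (1 + |x₀|)` -/

/-- **Lemma 3.1, quantitative form (energy)**: for a Leray profile with `U ∈ C^∞ ∩ L^q((EuclideanSpace ℝ (Fin 3)))`,
`3 ≤ q ≤ ∞`, `ν > 0`, `a ≥ 0`, and a local pressure control
`‖P − c_{x₀}‖_{L^{3/2}(B(x₀,1000R))} ≤ K_P(1 + |x₀|)`, the Dirichlet energy satisfies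
`∫_{B(x₀,324R)} |DU|² ≤ K (1 + |x₀|)` for all centres (Tsai: `‖∇U‖_{2,B₁(y₀)} = o(|y₀|^{1/2})`).
From (3.1) with the uniform local bounds `∫|U|², ∫|U|³ ≤ C` and Hölder
`∫|P − c||U| ≤ ‖P − c‖_{3/2}‖U‖₃`. [cite: Tsai1998, Lemma 3.1 (pp. 36–37)] -/
theorem IsLerayProfile.exists_integral_frobeniusNormSq_le (hprof : IsLerayProfile ν a U P)
    (hU : ContDiff ℝ ∞ U) (hν : 0 < ν) (ha : 0 ≤ a) {q : ℝ≥0∞} (hq : 3 ≤ q) (hUq : MemLp U q volume)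
    {R : ℝ} (hR : 0 < R) {c : (EuclideanSpace ℝ (Fin 3)) → ℝ} {K_P : ℝ} (hK_P : 0 ≤ K_P)
    (hPc : ∀ x₀ : (EuclideanSpace ℝ (Fin 3)), eLpNorm (fun x => P x - c x₀) (ENNReal.ofReal (3 / 2))
      (volume.restrict (ball x₀ (1000 * R))) ≤ ENNReal.ofReal (K_P * (1 + ‖x₀‖))) :
    ∃ K : ℝ, 0 ≤ K ∧ ∀ x₀ : (EuclideanSpace ℝ (Fin 3)), ∫ x in ball x₀ (324 * R), frobeniusNormSq (fderiv ℝ U x) ≤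
      K * (1 + ‖x₀‖) := by
  obtain ⟨C₁, C₂, hC₁, hC₂, h31⟩ := IsLerayProfile.exists_gradient_estimate_consts
  have hUc : Continuous U := hU.continuous
  have hU1 : ContDiff ℝ 1 U := hU.of_le (by norm_cast)
  have hP1 : ContDiff ℝ 1 P := (hprof.contDiff_two_pressure (hU.of_le (by norm_cast))).of_le one_le_two
  -- uniform data
  obtain ⟨MU, hMU0, hMUq⟩ : ∃ MU : ℝ, 0 ≤ MU ∧ eLpNorm U q volume ≤ ENNReal.ofReal MU :=
    ⟨(eLpNorm U q volume).toReal, ENNReal.toReal_nonneg, (ENNReal.ofReal_toReal hUq.eLpNorm_ne_top).ge⟩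
  set R' : ℝ := 324 * R with hR'
  have hR'0 : 0 < R' := by positivity
  set A₂ : ℝ := ((volume (closedBall (0 : (EuclideanSpace ℝ (Fin 3))) (2 * R'))) ^ (1 - 1 / (q / 2).toReal)).toReal * MU ^ 2 with hA₂
  set A₃ : ℝ := ((volume (closedBall (0 : (EuclideanSpace ℝ (Fin 3))) (2 * R'))) ^ (1 - 1 / (q / 3).toReal)).toReal * MU ^ 3 with hA₃
  have hA₂0 : 0 ≤ A₂ := mul_nonneg ENNReal.toReal_nonneg (pow_nonneg hMU0 2)
  have hA₃0 : 0 ≤ A₃ := mul_nonneg ENNReal.toReal_nonneg (pow_nonneg hMU0 3)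
  obtain ⟨CU3, hCU30, hCU3⟩ := exists_eLpNorm_restrict_ball_le_of_memLp hUc hUq (s := 3) (by norm_num) hq (1000 * R)
  have hJ₂ : ∀ x₀, ∫ x in closedBall x₀ (2 * R'), ‖U x‖ ^ 2 ≤ A₂ := fun x₀ =>
    setIntegral_norm_sq_le_of_eLpNorm_le hUc (le_trans (by norm_num) hq) hMU0 hMUq x₀ (2 * R')
  have hJ₃ : ∀ x₀, ∫ x in closedBall x₀ (2 * R'), ‖U x‖ ^ 3 ≤ A₃ := fun x₀ =>
    setIntegral_norm_pow_three_le_of_eLpNorm_le hUc hq hMU0 hMUq x₀ (2 * R')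
  have hJP : ∀ x₀, ∫ x in closedBall x₀ (2 * R'), |P x - c x₀| * ‖U x‖ ≤ K_P * (1 + ‖x₀‖) * CU3 := by
    intro x₀
    have h2R' : 2 * R' < 1000 * R := by rw [hR']; linarith
    have h := integral_closedBall_mul_le_eLpNorm_mul (hP1.continuous.sub continuous_const) hUc x₀ h2R'
      (f := fun x => P x - c x₀)
    refine h.trans ?_
    have e1 : (eLpNorm (fun x => P x - c x₀) (ENNReal.ofReal (3 / 2)) (volume.restrict (ball x₀ (1000 * R)))).toReal
        ≤ K_P * (1 + ‖x₀‖) :=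
      ENNReal.toReal_le_of_le_ofReal (by positivity) (hPc x₀)
    have e2 : (eLpNorm U 3 (volume.restrict (ball x₀ (1000 * R)))).toReal ≤ CU3 :=
      ENNReal.toReal_le_of_le_ofReal hCU30 (hCU3 x₀)
    exact mul_le_mul e1 e2 ENNReal.toReal_nonneg (by positivity)
  -- the constant
  set α : ℝ := ν * C₂ / (2 * R' ^ 2) + a / 2 with hα
  set β : ℝ := a * C₁ / (2 * R') with hβ
  have hα0 : 0 ≤ α := by positivity
  have hβ0 : 0 ≤ β := by positivity
  set K₀ : ℝ := ((α + β * (1 + 2 * R')) * A₂ + C₁ / (2 * R') * A₃ + C₁ / R' * (K_P * CU3)) / ν with hK₀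
  have hK₀0 : 0 ≤ K₀ := by positivity
  refine ⟨K₀, hK₀0, fun x₀ => ?_⟩
  have ht : 0 ≤ ‖x₀‖ := norm_nonneg _
  -- (3.1)
  have h := h31 hprof hU hν.le ha hR'0 x₀ (c x₀)
  have hJ₂x0 : 0 ≤ ∫ x in closedBall x₀ (2 * R'), ‖U x‖ ^ 2 := integral_nonneg fun x => by positivity
  have hcoef_eq : ν * C₂ / (2 * R' ^ 2) + a / 2 + a * C₁ * (‖x₀‖ + 2 * R') / (2 * R') =
      α + β * (‖x₀‖ + 2 * R') := by
    rw [hα, hβ]; ring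
  have hcoef : ν * C₂ / (2 * R' ^ 2) + a / 2 + a * C₁ * (‖x₀‖ + 2 * R') / (2 * R') ≤
      (α + β * (1 + 2 * R')) * (1 + ‖x₀‖) := by
    rw [hcoef_eq]
    have h1 : ‖x₀‖ + 2 * R' ≤ (1 + 2 * R') * (1 + ‖x₀‖) := by nlinarith
    nlinarith [mul_le_mul_of_nonneg_left h1 hβ0]
  have m1 : (ν * C₂ / (2 * R' ^ 2) + a / 2 + a * C₁ * (‖x₀‖ + 2 * R') / (2 * R')) *
      (∫ x in closedBall x₀ (2 * R'), ‖U x‖ ^ 2) ≤ (α + β * (1 + 2 * R')) * (1 + ‖x₀‖) * A₂ :=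
    mul_le_mul hcoef (hJ₂ x₀) hJ₂x0 (by positivity)
  have m2 : C₁ / (2 * R') * (∫ x in closedBall x₀ (2 * R'), ‖U x‖ ^ 3) ≤ C₁ / (2 * R') * A₃ :=
    mul_le_mul_of_nonneg_left (hJ₃ x₀) (by positivity)
  have m3 : C₁ / R' * (∫ x in closedBall x₀ (2 * R'), |P x - c x₀| * ‖U x‖) ≤
      C₁ / R' * (K_P * (1 + ‖x₀‖) * CU3) :=
    mul_le_mul_of_nonneg_left (hJP x₀) (by positivity)
  show ∫ x in ball x₀ R', frobeniusNormSq (fderiv ℝ U x) ≤ K₀ * (1 + ‖x₀‖)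
  · have hK₀ν : K₀ * ν = (α + β * (1 + 2 * R')) * A₂ + C₁ / (2 * R') * A₃ + C₁ / R' * (K_P * CU3) := by
      rw [hK₀]; field_simp
    have e3 : C₁ / (2 * R') * A₃ ≤ C₁ / (2 * R') * A₃ * (1 + ‖x₀‖) := by
      have : 0 ≤ C₁ / (2 * R') * A₃ := by positivity
      nlinarith
    have hν' : ν * ∫ x in ball x₀ R', frobeniusNormSq (fderiv ℝ U x) ≤ ν * (K₀ * (1 + ‖x₀‖)) := by
      have : ν * (K₀ * (1 + ‖x₀‖)) = (K₀ * ν) * (1 + ‖x₀‖) := by ring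
      rw [this, hK₀ν]
      linarith [m1, m2, m3, h, e3]
    exact le_of_mul_le_mul_left hν' hν

/-- **Lemma 3.1, quantitative form**: under the same hypotheses,
`‖DU‖_{L²(B(x₀,324R))} ≤ K (1 + |x₀|)` for all centres (`O(|y₀|^{1/2})` in print, rounded up
to a linear bound: `√(K₀(1+t)) ≤ (1 + K₀)(1 + t)`; `‖DU‖² ≤ |DU|²_F`).
[cite: Tsai1998, Lemma 3.1 (pp. 36–37)] -/
theorem IsLerayProfile.exists_eLpNorm_fderiv_two_le (hprof : IsLerayProfile ν a U P)
    (hU : ContDiff ℝ ∞ U) (hν : 0 < ν) (ha : 0 ≤ a) {q : ℝ≥0∞} (hq : 3 ≤ q) (hUq : MemLp U q volume)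
    {R : ℝ} (hR : 0 < R) {c : (EuclideanSpace ℝ (Fin 3)) → ℝ} {K_P : ℝ} (hK_P : 0 ≤ K_P)
    (hPc : ∀ x₀ : (EuclideanSpace ℝ (Fin 3)), eLpNorm (fun x => P x - c x₀) (ENNReal.ofReal (3 / 2))
      (volume.restrict (ball x₀ (1000 * R))) ≤ ENNReal.ofReal (K_P * (1 + ‖x₀‖))) :
    ∃ K : ℝ, 0 ≤ K ∧ ∀ x₀ : (EuclideanSpace ℝ (Fin 3)), eLpNorm (fun x => fderiv ℝ U x) 2
      (volume.restrict (ball x₀ (324 * R))) ≤ ENNReal.ofReal (K * (1 + ‖x₀‖)) := by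
  obtain ⟨K₀, hK₀0, hfrob⟩ := hprof.exists_integral_frobeniusNormSq_le hU hν ha hq hUq hR hK_P hPc
  have hU1 : ContDiff ℝ 1 U := hU.of_le (by norm_cast)
  refine ⟨1 + K₀, by positivity, fun x₀ => ?_⟩
  have ht : 0 ≤ ‖x₀‖ := norm_nonneg _
  have hmem : MemLp (fun x => fderiv ℝ U x) 2 (volume.restrict (ball x₀ (324 * R))) :=
    memLp_restrict_ball_of_continuous (hU1.continuous_fderiv one_ne_zero) x₀ (324 * R) 2
  have hgi : Integrable (fun x => frobeniusNormSq (fderiv ℝ U x)) (volume.restrict (ball x₀ (324 * R))) :=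
    ((continuous_frobeniusNormSq_fderiv hU1 one_ne_zero).continuousOn.integrableOn_compact
      (isCompact_closedBall x₀ (324 * R))).mono_set ball_subset_closedBall
  have hL2 := eLpNorm_two_le_sqrt_of_sq_le hmem (fun x => sq_opNorm_le_frobeniusNormSq (fderiv ℝ U x))
    hgi (hfrob x₀)
  refine hL2.trans (ENNReal.ofReal_le_ofReal ?_)
  have hy : 0 ≤ K₀ * (1 + ‖x₀‖) := by positivity
  calc Real.sqrt (K₀ * (1 + ‖x₀‖)) ≤ 1 + K₀ * (1 + ‖x₀‖) := by
        nlinarith [Real.sq_sqrt hy, Real.sqrt_nonneg (K₀ * (1 + ‖x₀‖))]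
    _ ≤ (1 + K₀) * (1 + ‖x₀‖) := by nlinarith

/-! ### Sobolev steps: the GNS inequality on balls with polynomial bookkeeping -/

/-- Coercions of the exponents used below. [folklore] -/
theorem coe_nnreal_three_halves : (((3 / 2 : ℝ≥0)) : ℝ≥0∞) = ENNReal.ofReal (3 / 2) := by
  rw [ofReal_three_halves, ENNReal.coe_div two_ne_zero, ENNReal.coe_ofNat, ENNReal.coe_ofNat]

/-- **GNS step with polynomial bookkeeping.** If `u ∈ C¹((EuclideanSpace ℝ (Fin 3)); F)` satisfies
`‖Du‖_{L^p(B(x₀,3s))} ≤ K₁ (1+|x₀|)^m` and `‖u‖_{L^p(B(x₀,3s))} ≤ K₂ (1+|x₀|)^m` for all centres,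
then `‖u‖_{L^{p*}(B(x₀,s))} ≤ K (1+|x₀|)^m` for all centres, `1/p* = 1/p − 1/3`, `1 ≤ p < 3`.
[cite: Tsai1998, §3.2 (p. 38)] -/
theorem exists_poly_bound_of_gns {F : Type*} [NormedAddCommGroup F] [NormedSpace ℝ F]
    [FiniteDimensional ℝ F] {u : (EuclideanSpace ℝ (Fin 3)) → F} (hu : ContDiff ℝ 1 u) {p p' : ℝ≥0} (hp : 1 ≤ p)
    (hp' : (p' : ℝ)⁻¹ = (p : ℝ)⁻¹ - 3⁻¹) {s : ℝ} (hs : 0 < s) {K₁ K₂ : ℝ} (hK₁ : 0 ≤ K₁) (hK₂ : 0 ≤ K₂)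
    {m : ℕ}
    (h₁ : ∀ x₀ : (EuclideanSpace ℝ (Fin 3)), eLpNorm (fun x => fderiv ℝ u x) p (volume.restrict (ball x₀ (3 * s))) ≤
      ENNReal.ofReal (K₁ * (1 + ‖x₀‖) ^ m))
    (h₂ : ∀ x₀ : (EuclideanSpace ℝ (Fin 3)), eLpNorm u p (volume.restrict (ball x₀ (3 * s))) ≤ ENNReal.ofReal (K₂ * (1 + ‖x₀‖) ^ m)) :
    ∃ K : ℝ, 0 ≤ K ∧ ∀ x₀ : (EuclideanSpace ℝ (Fin 3)), eLpNorm u p' (volume.restrict (ball x₀ s)) ≤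
      ENNReal.ofReal (K * (1 + ‖x₀‖) ^ m) := by
  obtain ⟨C, hC0, hgns⟩ := exists_eLpNorm_ball_le_eLpNorm_fderiv_add (F := F)
  set Kp : ℝ≥0 := SNormLESNormFDerivOfEqConst F (volume : Measure (EuclideanSpace ℝ (Fin 3))) p with hKp
  refine ⟨Kp * (K₁ + C / s * K₂), by positivity, fun x₀ => ?_⟩
  have ht : 0 ≤ ‖x₀‖ := norm_nonneg _
  refine (hgns hu hp hp' x₀ hs).trans ?_
  calc (Kp : ℝ≥0∞) * (eLpNorm (fun x => fderiv ℝ u x) p (volume.restrict (ball x₀ (3 * s))) +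
        ENNReal.ofReal (C / s) * eLpNorm u p (volume.restrict (ball x₀ (3 * s))))
      ≤ (Kp : ℝ≥0∞) * (ENNReal.ofReal (K₁ * (1 + ‖x₀‖) ^ m) +
          ENNReal.ofReal (C / s) * ENNReal.ofReal (K₂ * (1 + ‖x₀‖) ^ m)) := by
        gcongr
        · exact h₁ x₀
        · exact h₂ x₀
    _ = ENNReal.ofReal ((Kp * (K₁ + C / s * K₂)) * (1 + ‖x₀‖) ^ m) := by
        rw [← ENNReal.ofReal_mul (by positivity), ← ENNReal.ofReal_add (by positivity) (by positivity),
          ← ENNReal.ofReal_coe_nnreal, ← ENNReal.ofReal_mul (by positivity)]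
        congr 1
        ring

/-- **Step 2**: `‖U‖_{L⁶(B(x₀,108R))} ≤ K (1 + |x₀|)` (Sobolev `W^{1,2} ⊂ L⁶` on balls; Tsai:
"`‖U‖_{6,B₁} ≤ C‖∇U‖_{2,B₁} + C‖U‖_{q,B₁} = o(|y₀|^{1/2})`"). [cite: Tsai1998, proof of Lemma 3.1 (p. 37)] -/
theorem exists_eLpNorm_six_le {U : (EuclideanSpace ℝ (Fin 3)) → (EuclideanSpace ℝ (Fin 3))} (hU : ContDiff ℝ ∞ U) {q : ℝ≥0∞} (hq : 2 ≤ q)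
    (hUq : MemLp U q volume) {R : ℝ} (hR : 0 < R) {K₁ : ℝ} (hK₁ : 0 ≤ K₁)
    (hDU : ∀ x₀ : (EuclideanSpace ℝ (Fin 3)), eLpNorm (fun x => fderiv ℝ U x) 2 (volume.restrict (ball x₀ (324 * R))) ≤
      ENNReal.ofReal (K₁ * (1 + ‖x₀‖))) :
    ∃ K : ℝ, 0 ≤ K ∧ ∀ x₀ : (EuclideanSpace ℝ (Fin 3)), eLpNorm U 6 (volume.restrict (ball x₀ (108 * R))) ≤
      ENNReal.ofReal (K * (1 + ‖x₀‖)) := by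
  obtain ⟨C₂, hC₂0, hC₂⟩ := exists_eLpNorm_restrict_ball_le_of_memLp hU.continuous hUq (s := 2)
    (by norm_num) hq (324 * R)
  have h324 : (324 : ℝ) * R = 3 * (108 * R) := by ring
  have h₁ : ∀ x₀ : (EuclideanSpace ℝ (Fin 3)), eLpNorm (fun x => fderiv ℝ U x) ((2 : ℝ≥0) : ℝ≥0∞)
      (volume.restrict (ball x₀ (3 * (108 * R)))) ≤ ENNReal.ofReal (K₁ * (1 + ‖x₀‖) ^ 1) := fun x₀ => by
    rw [← h324, pow_one]; exact_mod_cast hDU x₀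
  have h₂ : ∀ x₀ : (EuclideanSpace ℝ (Fin 3)), eLpNorm U ((2 : ℝ≥0) : ℝ≥0∞) (volume.restrict (ball x₀ (3 * (108 * R)))) ≤
      ENNReal.ofReal (C₂ * (1 + ‖x₀‖) ^ 1) := fun x₀ => by
    rw [← h324]
    exact (by exact_mod_cast hC₂ x₀ : eLpNorm U ((2 : ℝ≥0) : ℝ≥0∞) (volume.restrict (ball x₀ (324 * R)))
      ≤ ENNReal.ofReal C₂).trans (ofReal_le_ofReal_poly hC₂0 (norm_nonneg _) 1)
  obtain ⟨K, hK0, hK⟩ := exists_poly_bound_of_gns (hU.of_le (by norm_cast)) (p := 2) (p' := 6) (by norm_num)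
    (by norm_num) (by positivity : 0 < 108 * R) hK₁ hC₂0 h₁ h₂
  refine ⟨K, hK0, fun x₀ => ?_⟩
  have := hK x₀
  rw [pow_one] at this
  exact_mod_cast this

/-! ### Bookkeeping: shrinking balls and lowering exponents under polynomial bounds -/

/-- Shrinking the ball preserves a bound. [folklore] -/
theorem eLpNorm_restrict_ball_mono {G : Type*} [NormedAddCommGroup G] (f : (EuclideanSpace ℝ (Fin 3)) → G) (p : ℝ≥0∞)
    (x₀ : (EuclideanSpace ℝ (Fin 3))) {r R : ℝ} (h : r ≤ R) :
    eLpNorm f p (volume.restrict (ball x₀ r)) ≤ eLpNorm f p (volume.restrict (ball x₀ R)) :=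
  eLpNorm_mono_measure f (Measure.restrict_mono (ball_subset_ball h) le_rfl)

/-- **Lowering the exponent under a polynomial bound**: if `‖f‖_{L^{s'}(B(x₀,R))} ≤ K (1+|x₀|)^m` for
all centres and `1 ≤ s ≤ s'`, then `‖f‖_{L^{s}(B(x₀,R))} ≤ K' (1+|x₀|)^m` for all centres. [folklore] -/
theorem exists_poly_bound_of_exponent_le {G : Type*} [NormedAddCommGroup G] {f : (EuclideanSpace ℝ (Fin 3)) → G}
    (hf : Continuous f) {s s' : ℝ≥0∞} (hs1 : 1 ≤ s) (hss' : s ≤ s') (R : ℝ) {K : ℝ} (hK : 0 ≤ K) {m : ℕ}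
    (h : ∀ x₀ : (EuclideanSpace ℝ (Fin 3)), eLpNorm f s' (volume.restrict (ball x₀ R)) ≤ ENNReal.ofReal (K * (1 + ‖x₀‖) ^ m)) :
    ∃ K' : ℝ, 0 ≤ K' ∧ ∀ x₀ : (EuclideanSpace ℝ (Fin 3)), eLpNorm f s (volume.restrict (ball x₀ R)) ≤
      ENNReal.ofReal (K' * (1 + ‖x₀‖) ^ m) := by
  set V : ℝ≥0∞ := (volume (ball (0 : (EuclideanSpace ℝ (Fin 3))) R)) ^ (1 / s.toReal - 1 / s'.toReal) with hV
  have hVlt : V < ⊤ := volume_ball_rpow_lt_top R (one_div_toReal_sub_nonneg hs1 hss')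
  refine ⟨V.toReal * K, by positivity, fun x₀ => ?_⟩
  calc eLpNorm f s (volume.restrict (ball x₀ R))
      ≤ eLpNorm f s' (volume.restrict (ball x₀ R)) * V := eLpNorm_ball_le_mul_eLpNorm hf.aestronglyMeasurable hss' x₀ R
    _ ≤ ENNReal.ofReal (K * (1 + ‖x₀‖) ^ m) * V := by gcongr; exact h x₀
    _ = ENNReal.ofReal ((V.toReal * K) * (1 + ‖x₀‖) ^ m) := by
        rw [mul_comm, const_mul_ofReal_poly hVlt.ne]

variable (a) in
/-- **Polynomial bound for the body force** from polynomial bounds on `U`, `DU` in `L^p` and on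
`DU`, `U` in `L^{q₁}`, `L^{q₂}` (`1/p = 1/q₁ + 1/q₂`) over the same ball (degree raised by one by
the drift factor `|x₀| + R`, and by `m₃ + m₄` by the product). [cite: Tsai1998, §3.2 (p. 38)] -/
theorem exists_poly_bound_bodyForce {U : (EuclideanSpace ℝ (Fin 3)) → (EuclideanSpace ℝ (Fin 3))} (hU : ContDiff ℝ 1 U) {R : ℝ} (hR : 0 < R)
    {p q₁ q₂ : ℝ≥0∞} (hp : 1 ≤ p) [ENNReal.HolderTriple q₁ q₂ p] {K₁ K₂ K₃ K₄ : ℝ} (hK₁ : 0 ≤ K₁)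
    (hK₂ : 0 ≤ K₂) (hK₃ : 0 ≤ K₃) (hK₄ : 0 ≤ K₄) {m₁ m₂ m₃ m₄ : ℕ}
    (h₁ : ∀ x₀ : (EuclideanSpace ℝ (Fin 3)), eLpNorm U p (volume.restrict (ball x₀ R)) ≤ ENNReal.ofReal (K₁ * (1 + ‖x₀‖) ^ m₁))
    (h₂ : ∀ x₀ : (EuclideanSpace ℝ (Fin 3)), eLpNorm (fun x => fderiv ℝ U x) p (volume.restrict (ball x₀ R)) ≤
      ENNReal.ofReal (K₂ * (1 + ‖x₀‖) ^ m₂))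
    (h₃ : ∀ x₀ : (EuclideanSpace ℝ (Fin 3)), eLpNorm (fun x => fderiv ℝ U x) q₁ (volume.restrict (ball x₀ R)) ≤
      ENNReal.ofReal (K₃ * (1 + ‖x₀‖) ^ m₃))
    (h₄ : ∀ x₀ : (EuclideanSpace ℝ (Fin 3)), eLpNorm U q₂ (volume.restrict (ball x₀ R)) ≤ ENNReal.ofReal (K₄ * (1 + ‖x₀‖) ^ m₄)) :
    ∃ K : ℝ, 0 ≤ K ∧ ∀ x₀ : (EuclideanSpace ℝ (Fin 3)),
      eLpNorm (fun x => a • U x + a • fderiv ℝ U x x + convect U U x) p (volume.restrict (ball x₀ R)) ≤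
        ENNReal.ofReal (K * (1 + ‖x₀‖) ^ (max (max m₁ (m₂ + 1)) (m₃ + m₄))) := by
  set M : ℕ := max (max m₁ (m₂ + 1)) (m₃ + m₄) with hM
  refine ⟨|a| * K₁ + |a| * max 1 R * K₂ + K₃ * K₄, by positivity, fun x₀ => ?_⟩
  have ht : 0 ≤ ‖x₀‖ := norm_nonneg _
  refine (eLpNorm_bodyForce_le hU a x₀ hR.le hp (q₁ := q₁) (q₂ := q₂)).trans ?_
  -- each term as a polynomial bound of degree `M`
  have hmR : ‖x₀‖ + R ≤ max 1 R * (1 + ‖x₀‖) := add_le_max_one_mul_one_add ht R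
  have t1 : ENNReal.ofReal |a| * eLpNorm U p (volume.restrict (ball x₀ R)) ≤
      ENNReal.ofReal ((|a| * K₁) * (1 + ‖x₀‖) ^ M) := by
    calc ENNReal.ofReal |a| * eLpNorm U p (volume.restrict (ball x₀ R))
        ≤ ENNReal.ofReal |a| * ENNReal.ofReal (K₁ * (1 + ‖x₀‖) ^ m₁) := by gcongr; exact h₁ x₀
      _ = ENNReal.ofReal ((|a| * K₁) * (1 + ‖x₀‖) ^ m₁) := by
          rw [← ENNReal.ofReal_mul (abs_nonneg a), mul_assoc]
      _ ≤ ENNReal.ofReal ((|a| * K₁) * (1 + ‖x₀‖) ^ M) :=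
          ofReal_poly_le_of_le (by positivity) ht (by rw [hM]; omega)
  have t2 : ENNReal.ofReal (|a| * (‖x₀‖ + R)) * eLpNorm (fun x => fderiv ℝ U x) p (volume.restrict (ball x₀ R)) ≤
      ENNReal.ofReal ((|a| * max 1 R * K₂) * (1 + ‖x₀‖) ^ M) := by
    calc ENNReal.ofReal (|a| * (‖x₀‖ + R)) * eLpNorm (fun x => fderiv ℝ U x) p (volume.restrict (ball x₀ R))
        ≤ ENNReal.ofReal (|a| * (max 1 R * (1 + ‖x₀‖))) * ENNReal.ofReal (K₂ * (1 + ‖x₀‖) ^ m₂) := by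
          gcongr
          exact h₂ x₀
      _ = ENNReal.ofReal ((|a| * max 1 R * K₂) * (1 + ‖x₀‖) ^ (m₂ + 1)) := by
          rw [← ENNReal.ofReal_mul (by positivity), pow_succ]
          ring_nf
      _ ≤ ENNReal.ofReal ((|a| * max 1 R * K₂) * (1 + ‖x₀‖) ^ M) :=
          ofReal_poly_le_of_le (by positivity) ht (by rw [hM]; omega)
  have t3 : eLpNorm (fun x => fderiv ℝ U x) q₁ (volume.restrict (ball x₀ R)) *
      eLpNorm U q₂ (volume.restrict (ball x₀ R)) ≤ ENNReal.ofReal ((K₃ * K₄) * (1 + ‖x₀‖) ^ M) := by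
    calc eLpNorm (fun x => fderiv ℝ U x) q₁ (volume.restrict (ball x₀ R)) * eLpNorm U q₂ (volume.restrict (ball x₀ R))
        ≤ ENNReal.ofReal (K₃ * (1 + ‖x₀‖) ^ m₃) * ENNReal.ofReal (K₄ * (1 + ‖x₀‖) ^ m₄) := by
          gcongr
          · exact h₃ x₀
          · exact h₄ x₀
      _ = ENNReal.ofReal ((K₃ * K₄) * (1 + ‖x₀‖) ^ (m₃ + m₄)) := ofReal_poly_mul hK₃ ht m₃ m₄
      _ ≤ ENNReal.ofReal ((K₃ * K₄) * (1 + ‖x₀‖) ^ M) :=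
          ofReal_poly_le_of_le (by positivity) ht (by rw [hM]; omega)
  calc ENNReal.ofReal |a| * eLpNorm U p (volume.restrict (ball x₀ R)) +
        ENNReal.ofReal (|a| * (‖x₀‖ + R)) * eLpNorm (fun x => fderiv ℝ U x) p (volume.restrict (ball x₀ R)) +
        eLpNorm (fun x => fderiv ℝ U x) q₁ (volume.restrict (ball x₀ R)) * eLpNorm U q₂ (volume.restrict (ball x₀ R))
      ≤ ENNReal.ofReal ((|a| * K₁) * (1 + ‖x₀‖) ^ M) + ENNReal.ofReal ((|a| * max 1 R * K₂) * (1 + ‖x₀‖) ^ M)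
          + ENNReal.ofReal ((K₃ * K₄) * (1 + ‖x₀‖) ^ M) := add_le_add (add_le_add t1 t2) t3
    _ = ENNReal.ofReal ((|a| * K₁ + |a| * max 1 R * K₂ + K₃ * K₄) * (1 + ‖x₀‖) ^ M) := by
        rw [← ENNReal.ofReal_add (by positivity) (by positivity),
          ← ENNReal.ofReal_add (by positivity) (by positivity)]
        ring_nf

/-! ### The Stokes step and the two Sobolev steps, with polynomial bookkeeping -/

/-- **Stokes step.** For a Leray profile with `U ∈ C^∞`, `ν > 0`, `1 < r < ∞`, `S > 0`: polynomial
bounds (common degree `m`) for `F`, `U`, `DU`, `P − c_{x₀}` in `L^r(B(x₀, 2S))` give polynomial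
bounds of degree `m` for `D²U` and `∇P` in `L^r(B(x₀, S))` (the interior estimate (3.2), named fact
`stokes_interior_Lr_estimate`). [cite: Tsai1998, (3.2) and §3.2 (pp. 37–38)] -/
theorem IsLerayProfile.exists_poly_bound_stokes (hSt : stokes_interior_Lr_estimate)
    (hprof : IsLerayProfile ν a U P) (hU : ContDiff ℝ ∞ U) (hν : 0 < ν) {r : ℝ≥0∞} (hr : 1 < r)
    (hr' : r < ⊤) {S : ℝ} (hS : 0 < S) {c : (EuclideanSpace ℝ (Fin 3)) → ℝ} {KF KU KD KP : ℝ} (hKF : 0 ≤ KF) (hKU : 0 ≤ KU)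
    (hKD : 0 ≤ KD) (hKP : 0 ≤ KP) {m : ℕ}
    (hF : ∀ x₀ : (EuclideanSpace ℝ (Fin 3)), eLpNorm (fun x => a • U x + a • fderiv ℝ U x x + convect U U x) r
      (volume.restrict (ball x₀ (2 * S))) ≤ ENNReal.ofReal (KF * (1 + ‖x₀‖) ^ m))
    (hUr : ∀ x₀ : (EuclideanSpace ℝ (Fin 3)), eLpNorm U r (volume.restrict (ball x₀ (2 * S))) ≤ ENNReal.ofReal (KU * (1 + ‖x₀‖) ^ m))
    (hDr : ∀ x₀ : (EuclideanSpace ℝ (Fin 3)), eLpNorm (fun x => fderiv ℝ U x) r (volume.restrict (ball x₀ (2 * S))) ≤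
      ENNReal.ofReal (KD * (1 + ‖x₀‖) ^ m))
    (hPr : ∀ x₀ : (EuclideanSpace ℝ (Fin 3)), eLpNorm (fun x => P x - c x₀) r (volume.restrict (ball x₀ (2 * S))) ≤
      ENNReal.ofReal (KP * (1 + ‖x₀‖) ^ m)) :
    ∃ K : ℝ, 0 ≤ K ∧ ∀ x₀ : (EuclideanSpace ℝ (Fin 3)),
      eLpNorm (fun x => iteratedFDeriv ℝ 2 U x) r (volume.restrict (ball x₀ S)) ≤
          ENNReal.ofReal (K * (1 + ‖x₀‖) ^ m) ∧
        eLpNorm (fun x => fderiv ℝ P x) r (volume.restrict (ball x₀ S)) ≤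
          ENNReal.ofReal (K * (1 + ‖x₀‖) ^ m) := by
  obtain ⟨C, hC⟩ := hprof.stokes_estimate hSt hU hν hr hr' hS
  refine ⟨C * (KF + KU + KD + KP), by positivity, fun x₀ => ?_⟩
  have ht : 0 ≤ ‖x₀‖ := norm_nonneg _
  have h := hC x₀ (c x₀)
  have hsum : (C : ℝ≥0∞) * (eLpNorm (fun x => a • U x + a • fderiv ℝ U x x + convect U U x) r
        (volume.restrict (ball x₀ (2 * S))) + eLpNorm U r (volume.restrict (ball x₀ (2 * S))) +
        eLpNorm (fun x => fderiv ℝ U x) r (volume.restrict (ball x₀ (2 * S))) +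
        eLpNorm (fun x => P x - c x₀) r (volume.restrict (ball x₀ (2 * S)))) ≤
      ENNReal.ofReal ((C * (KF + KU + KD + KP)) * (1 + ‖x₀‖) ^ m) := by
    calc (C : ℝ≥0∞) * (eLpNorm (fun x => a • U x + a • fderiv ℝ U x x + convect U U x) r
          (volume.restrict (ball x₀ (2 * S))) + eLpNorm U r (volume.restrict (ball x₀ (2 * S))) +
          eLpNorm (fun x => fderiv ℝ U x) r (volume.restrict (ball x₀ (2 * S))) +
          eLpNorm (fun x => P x - c x₀) r (volume.restrict (ball x₀ (2 * S))))
        ≤ (C : ℝ≥0∞) * (ENNReal.ofReal (KF * (1 + ‖x₀‖) ^ m) + ENNReal.ofReal (KU * (1 + ‖x₀‖) ^ m) +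
            ENNReal.ofReal (KD * (1 + ‖x₀‖) ^ m) + ENNReal.ofReal (KP * (1 + ‖x₀‖) ^ m)) := by
          gcongr
          · exact hF x₀
          · exact hUr x₀
          · exact hDr x₀
          · exact hPr x₀
      _ = ENNReal.ofReal ((C * (KF + KU + KD + KP)) * (1 + ‖x₀‖) ^ m) := by
          rw [← ENNReal.ofReal_add (by positivity) (by positivity),
            ← ENNReal.ofReal_add (by positivity) (by positivity),
            ← ENNReal.ofReal_add (by positivity) (by positivity),
            ← ENNReal.ofReal_coe_nnreal, ← ENNReal.ofReal_mul (by positivity)]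
          ring_nf
  have hboth := h.trans hsum
  exact ⟨le_trans le_self_add hboth, le_trans le_add_self hboth⟩

/-- **Sobolev step for `DU`**: polynomial bounds (degree `m`) for `D²U`, `DU` in `L^p(B(x₀,3s))` give
a polynomial bound of degree `m` for `DU` in `L^{p*}(B(x₀,s))`, `1/p* = 1/p − 1/3`.
[cite: Tsai1998, §3.2 (p. 38)] -/
theorem exists_poly_bound_gns_fderiv {U : (EuclideanSpace ℝ (Fin 3)) → (EuclideanSpace ℝ (Fin 3))} (hU : ContDiff ℝ ∞ U) {p p' : ℝ≥0} (hp : 1 ≤ p)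
    (hp' : (p' : ℝ)⁻¹ = (p : ℝ)⁻¹ - 3⁻¹) {s : ℝ} (hs : 0 < s) {K₁ K₂ : ℝ} (hK₁ : 0 ≤ K₁) (hK₂ : 0 ≤ K₂)
    {m : ℕ}
    (h₁ : ∀ x₀ : (EuclideanSpace ℝ (Fin 3)), eLpNorm (fun x => iteratedFDeriv ℝ 2 U x) p (volume.restrict (ball x₀ (3 * s))) ≤
      ENNReal.ofReal (K₁ * (1 + ‖x₀‖) ^ m))
    (h₂ : ∀ x₀ : (EuclideanSpace ℝ (Fin 3)), eLpNorm (fun x => fderiv ℝ U x) p (volume.restrict (ball x₀ (3 * s))) ≤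
      ENNReal.ofReal (K₂ * (1 + ‖x₀‖) ^ m)) :
    ∃ K : ℝ, 0 ≤ K ∧ ∀ x₀ : (EuclideanSpace ℝ (Fin 3)), eLpNorm (fun x => fderiv ℝ U x) p' (volume.restrict (ball x₀ s)) ≤
      ENNReal.ofReal (K * (1 + ‖x₀‖) ^ m) := by
  have hu : ContDiff ℝ 1 (fun x => fderiv ℝ U x) := hU.fderiv_right (m := 1) (by norm_cast)
  have h₁' : ∀ x₀ : (EuclideanSpace ℝ (Fin 3)), eLpNorm (fun x => fderiv ℝ (fun y => fderiv ℝ U y) x) p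
      (volume.restrict (ball x₀ (3 * s))) ≤ ENNReal.ofReal (K₁ * (1 + ‖x₀‖) ^ m) := fun x₀ => by
    have he : eLpNorm (fun x => fderiv ℝ (fun y => fderiv ℝ U y) x) p (volume.restrict (ball x₀ (3 * s))) =
        eLpNorm (fun x => iteratedFDeriv ℝ 2 U x) p (volume.restrict (ball x₀ (3 * s))) := by
      rw [← eLpNorm_norm (fun x => fderiv ℝ (fun y => fderiv ℝ U y) x),
        ← eLpNorm_norm (fun x => iteratedFDeriv ℝ 2 U x)]
      refine eLpNorm_congr_ae (Eventually.of_forall fun x => ?_)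
      show ‖fderiv ℝ (fderiv ℝ U) x‖ = ‖iteratedFDeriv ℝ 2 U x‖
      rw [← norm_iteratedFDeriv_fderiv (n := 1), ← norm_iteratedFDeriv_fderiv (n := 0),
        norm_iteratedFDeriv_zero]
    rw [he]; exact h₁ x₀
  exact exists_poly_bound_of_gns hu hp hp' hs hK₁ hK₂ h₁' h₂

/-- **Sobolev step for the pressure**: polynomial bounds (degree `m`) for `∇P`, `P − c_{x₀}` in
`L^p(B(x₀,3s))` give a polynomial bound of degree `m` for `P − c_{x₀}` in `L^{p*}(B(x₀,s))`.
[cite: Tsai1998, §3.2 (p. 38)] -/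
theorem exists_poly_bound_gns_pressure {P : (EuclideanSpace ℝ (Fin 3)) → ℝ} (hP : ContDiff ℝ 1 P) {c : (EuclideanSpace ℝ (Fin 3)) → ℝ} {p p' : ℝ≥0}
    (hp : 1 ≤ p) (hp' : (p' : ℝ)⁻¹ = (p : ℝ)⁻¹ - 3⁻¹) {s : ℝ} (hs : 0 < s) {K₁ K₂ : ℝ} (hK₁ : 0 ≤ K₁)
    (hK₂ : 0 ≤ K₂) {m : ℕ}
    (h₁ : ∀ x₀ : (EuclideanSpace ℝ (Fin 3)), eLpNorm (fun x => fderiv ℝ P x) p (volume.restrict (ball x₀ (3 * s))) ≤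
      ENNReal.ofReal (K₁ * (1 + ‖x₀‖) ^ m))
    (h₂ : ∀ x₀ : (EuclideanSpace ℝ (Fin 3)), eLpNorm (fun x => P x - c x₀) p (volume.restrict (ball x₀ (3 * s))) ≤
      ENNReal.ofReal (K₂ * (1 + ‖x₀‖) ^ m)) :
    ∃ K : ℝ, 0 ≤ K ∧ ∀ x₀ : (EuclideanSpace ℝ (Fin 3)), eLpNorm (fun x => P x - c x₀) p' (volume.restrict (ball x₀ s)) ≤
      ENNReal.ofReal (K * (1 + ‖x₀‖) ^ m) := by
  obtain ⟨C, hC0, hgns⟩ := exists_eLpNorm_ball_le_eLpNorm_fderiv_add (F := ℝ)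
  set Kp : ℝ≥0 := SNormLESNormFDerivOfEqConst ℝ (volume : Measure (EuclideanSpace ℝ (Fin 3))) p with hKp
  refine ⟨Kp * (K₁ + C / s * K₂), by positivity, fun x₀ => ?_⟩
  have ht : 0 ≤ ‖x₀‖ := norm_nonneg _
  have hu : ContDiff ℝ 1 fun x => P x - c x₀ := hP.sub contDiff_const
  have hD : (fun x => fderiv ℝ (fun y => P y - c x₀) x) = fun x => fderiv ℝ P x :=
    funext fun x => fderiv_sub_const (c x₀)
  refine (hgns hu hp hp' x₀ hs).trans ?_
  rw [hD]
  calc (Kp : ℝ≥0∞) * (eLpNorm (fun x => fderiv ℝ P x) p (volume.restrict (ball x₀ (3 * s))) +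
        ENNReal.ofReal (C / s) * eLpNorm (fun x => P x - c x₀) p (volume.restrict (ball x₀ (3 * s))))
      ≤ (Kp : ℝ≥0∞) * (ENNReal.ofReal (K₁ * (1 + ‖x₀‖) ^ m) +
          ENNReal.ofReal (C / s) * ENNReal.ofReal (K₂ * (1 + ‖x₀‖) ^ m)) := by
        gcongr
        · exact h₁ x₀
        · exact h₂ x₀
    _ = ENNReal.ofReal ((Kp * (K₁ + C / s * K₂)) * (1 + ‖x₀‖) ^ m) := by
        rw [← ENNReal.ofReal_mul (by positivity), ← ENNReal.ofReal_add (by positivity) (by positivity),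
          ← ENNReal.ofReal_coe_nnreal, ← ENNReal.ofReal_mul (by positivity)]
        congr 1
        ring

/-! ### The chain -/

/-- Degree-zero polynomial form of a uniform bound. [folklore] -/
theorem poly_zero_of_uniform {G : Type*} [NormedAddCommGroup G] {f : (EuclideanSpace ℝ (Fin 3)) → G} {s : ℝ≥0∞} {R C : ℝ}
    (h : ∀ x₀ : (EuclideanSpace ℝ (Fin 3)), eLpNorm f s (volume.restrict (ball x₀ R)) ≤ ENNReal.ofReal C) (m : ℕ) (hC : 0 ≤ C) :
    ∀ x₀ : (EuclideanSpace ℝ (Fin 3)), eLpNorm f s (volume.restrict (ball x₀ R)) ≤ ENNReal.ofReal (C * (1 + ‖x₀‖) ^ m) :=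
  fun x₀ => (h x₀).trans (ofReal_le_ofReal_poly hC (norm_nonneg _) m)

/-- **Round one of the bootstrap** (Tsai 1998, p. 38, `r = 3/2`): from Lemma 3.1 and the local pressure
control, `‖DU‖_{L³(B(x₀,18R))}` and `‖P − c_{x₀}‖_{L³(B(x₀,18R))}` grow at most quadratically, and
`‖DU‖_{L²(B(x₀,324R))}`, `‖U‖_{L⁶(B(x₀,108R))}` at most linearly in `|x₀|`.
[cite: Tsai1998, §3.2 (p. 38)] -/
theorem IsLerayProfile.bootstrap_round_one (hSt : stokes_interior_Lr_estimate)
    (hprof : IsLerayProfile ν a U P) (hU : ContDiff ℝ ∞ U) (hν : 0 < ν) (ha : 0 ≤ a) {q : ℝ≥0∞}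
    (hq : 3 ≤ q) (hUq : MemLp U q volume) {R : ℝ} (hR : 0 < R) {c : (EuclideanSpace ℝ (Fin 3)) → ℝ} {K_P : ℝ} (hK_P : 0 ≤ K_P)
    (hPc : ∀ x₀ : (EuclideanSpace ℝ (Fin 3)), eLpNorm (fun x => P x - c x₀) (ENNReal.ofReal (3 / 2))
      (volume.restrict (ball x₀ (1000 * R))) ≤ ENNReal.ofReal (K_P * (1 + ‖x₀‖))) :
    ∃ K : ℝ, 0 ≤ K ∧ ∀ x₀ : (EuclideanSpace ℝ (Fin 3)),
      eLpNorm (fun x => fderiv ℝ U x) 2 (volume.restrict (ball x₀ (324 * R))) ≤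
          ENNReal.ofReal (K * (1 + ‖x₀‖) ^ 1) ∧
      eLpNorm U 6 (volume.restrict (ball x₀ (108 * R))) ≤ ENNReal.ofReal (K * (1 + ‖x₀‖) ^ 1) ∧
      eLpNorm (fun x => fderiv ℝ U x) 3 (volume.restrict (ball x₀ (18 * R))) ≤
          ENNReal.ofReal (K * (1 + ‖x₀‖) ^ 2) ∧
      eLpNorm (fun x => P x - c x₀) 3 (volume.restrict (ball x₀ (18 * R))) ≤
          ENNReal.ofReal (K * (1 + ‖x₀‖) ^ 2) := by
  have hUc : Continuous U := hU.continuous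
  have hU1 : ContDiff ℝ 1 U := hU.of_le (by norm_cast)
  have hP1 : ContDiff ℝ 1 P := (hprof.contDiff_two_pressure (hU.of_le (by norm_cast))).of_le one_le_two
  have hDUc : Continuous fun x => fderiv ℝ U x := hU1.continuous_fderiv one_ne_zero
  have h32 : (1 : ℝ≥0∞) < ENNReal.ofReal (3 / 2) := by
    rw [← ENNReal.ofReal_one]; exact (ENNReal.ofReal_lt_ofReal_iff (by norm_num)).2 (by norm_num)
  have h32' : (1 : ℝ≥0∞) ≤ ENNReal.ofReal (3 / 2) := h32.le
  have h32two : ENNReal.ofReal (3 / 2) ≤ 2 := by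
    rw [← ENNReal.ofReal_ofNat]; exact ENNReal.ofReal_le_ofReal (by norm_num)
  have h32q : ENNReal.ofReal (3 / 2) ≤ q := h32two.trans (le_trans (by norm_num) hq)
  -- S1: `DU ∈ L²(324R)`, degree 1
  obtain ⟨K₁, hK₁, hS1⟩ := hprof.exists_eLpNorm_fderiv_two_le hU hν ha hq hUq hR hK_P hPc
  have hS1' : ∀ x₀ : (EuclideanSpace ℝ (Fin 3)), eLpNorm (fun x => fderiv ℝ U x) 2 (volume.restrict (ball x₀ (324 * R))) ≤
      ENNReal.ofReal (K₁ * (1 + ‖x₀‖) ^ 1) := fun x₀ => by rw [pow_one]; exact hS1 x₀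
  -- S2: `U ∈ L⁶(108R)`, degree 1
  obtain ⟨K₂, hK₂, hS2⟩ := exists_eLpNorm_six_le hU (le_trans (by norm_num) hq) hUq hR hK₁ hS1
  have hS2' : ∀ x₀ : (EuclideanSpace ℝ (Fin 3)), eLpNorm U 6 (volume.restrict (ball x₀ (108 * R))) ≤
      ENNReal.ofReal (K₂ * (1 + ‖x₀‖) ^ 1) := fun x₀ => by rw [pow_one]; exact hS2 x₀
  -- uniform `U ∈ L^{3/2}(108R)`
  obtain ⟨CU, hCU0, hCU⟩ := exists_eLpNorm_restrict_ball_le_of_memLp hUc hUq h32' h32q (108 * R)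
  -- `DU ∈ L²(108R)` and `DU ∈ L^{3/2}(108R)`, degree 1
  have hD2 : ∀ x₀ : (EuclideanSpace ℝ (Fin 3)), eLpNorm (fun x => fderiv ℝ U x) 2 (volume.restrict (ball x₀ (108 * R))) ≤
      ENNReal.ofReal (K₁ * (1 + ‖x₀‖) ^ 1) := fun x₀ =>
    (eLpNorm_restrict_ball_mono _ _ x₀ (by linarith)).trans (hS1' x₀)
  obtain ⟨K₃, hK₃, hD32⟩ := exists_poly_bound_of_exponent_le hDUc h32' h32two (108 * R) hK₁ hD2
  -- S3: `F ∈ L^{3/2}(108R)`, degree 2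
  haveI := holderTriple_two_six
  obtain ⟨K₄, hK₄, hS3⟩ := exists_poly_bound_bodyForce a hU1 (by positivity : 0 < 108 * R) h32'
    (q₁ := 2) (q₂ := 6) hCU0 hK₃ hK₁ hK₂ (poly_zero_of_uniform hCU 0 hCU0) hD32 hD2 hS2'
  have hdeg3 : max (max 0 (1 + 1)) (1 + 1) = 2 := by norm_num
  rw [hdeg3] at hS3
  -- S4: Stokes at `r = 3/2`, `S = 54R`
  have h108 : (108 : ℝ) * R = 2 * (54 * R) := by ring
  have hPc' : ∀ x₀ : (EuclideanSpace ℝ (Fin 3)), eLpNorm (fun x => P x - c x₀) (ENNReal.ofReal (3 / 2))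
      (volume.restrict (ball x₀ (2 * (54 * R)))) ≤ ENNReal.ofReal (K_P * (1 + ‖x₀‖) ^ 2) := fun x₀ => by
    rw [← h108]
    refine ((eLpNorm_restrict_ball_mono _ _ x₀ (by linarith)).trans (hPc x₀)).trans ?_
    have := ofReal_poly_le_of_le hK_P (norm_nonneg x₀) (m := 1) (m' := 2) one_le_two
    rwa [pow_one] at this
  have hU32 : ∀ x₀ : (EuclideanSpace ℝ (Fin 3)), eLpNorm U (ENNReal.ofReal (3 / 2)) (volume.restrict (ball x₀ (2 * (54 * R)))) ≤
      ENNReal.ofReal (CU * (1 + ‖x₀‖) ^ 2) := fun x₀ => by rw [← h108]; exact poly_zero_of_uniform hCU 2 hCU0 x₀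
  have hD32' : ∀ x₀ : (EuclideanSpace ℝ (Fin 3)), eLpNorm (fun x => fderiv ℝ U x) (ENNReal.ofReal (3 / 2))
      (volume.restrict (ball x₀ (2 * (54 * R)))) ≤ ENNReal.ofReal (K₃ * (1 + ‖x₀‖) ^ 2) := fun x₀ => by
    rw [← h108]; exact (hD32 x₀).trans (ofReal_poly_le_of_le hK₃ (norm_nonneg x₀) one_le_two)
  have hS3' : ∀ x₀ : (EuclideanSpace ℝ (Fin 3)), eLpNorm (fun x => a • U x + a • fderiv ℝ U x x + convect U U x) (ENNReal.ofReal (3 / 2))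
      (volume.restrict (ball x₀ (2 * (54 * R)))) ≤ ENNReal.ofReal (K₄ * (1 + ‖x₀‖) ^ 2) := fun x₀ => by
    rw [← h108]; exact hS3 x₀
  obtain ⟨K₅, hK₅, hS4⟩ := hprof.exists_poly_bound_stokes hSt hU hν h32 ENNReal.ofReal_lt_top
    (by positivity : 0 < 54 * R) hK₄ hCU0 hK₃ hK_P hS3' hU32 hD32' hPc'
  -- S5: Sobolev `3/2 → 3` at `s = 18R`
  have h54 : (54 : ℝ) * R = 3 * (18 * R) := by ring
  have hp32 : ((3 / 2 : ℝ≥0) : ℝ)⁻¹ - 3⁻¹ = ((3 : ℝ≥0) : ℝ)⁻¹ := by push_cast; norm_num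
  have hD2U : ∀ x₀ : (EuclideanSpace ℝ (Fin 3)), eLpNorm (fun x => iteratedFDeriv ℝ 2 U x) ((3 / 2 : ℝ≥0) : ℝ≥0∞)
      (volume.restrict (ball x₀ (3 * (18 * R)))) ≤ ENNReal.ofReal (K₅ * (1 + ‖x₀‖) ^ 2) := fun x₀ => by
    rw [← h54, coe_nnreal_three_halves]; exact (hS4 x₀).1
  have hDP : ∀ x₀ : (EuclideanSpace ℝ (Fin 3)), eLpNorm (fun x => fderiv ℝ P x) ((3 / 2 : ℝ≥0) : ℝ≥0∞)
      (volume.restrict (ball x₀ (3 * (18 * R)))) ≤ ENNReal.ofReal (K₅ * (1 + ‖x₀‖) ^ 2) := fun x₀ => by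
    rw [← h54, coe_nnreal_three_halves]; exact (hS4 x₀).2
  have hDU54 : ∀ x₀ : (EuclideanSpace ℝ (Fin 3)), eLpNorm (fun x => fderiv ℝ U x) ((3 / 2 : ℝ≥0) : ℝ≥0∞)
      (volume.restrict (ball x₀ (3 * (18 * R)))) ≤ ENNReal.ofReal (K₃ * (1 + ‖x₀‖) ^ 2) := fun x₀ => by
    rw [← h54, coe_nnreal_three_halves]
    exact ((eLpNorm_restrict_ball_mono _ _ x₀ (by linarith)).trans (hD32 x₀)).trans
      (ofReal_poly_le_of_le hK₃ (norm_nonneg x₀) one_le_two)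
  have hP54 : ∀ x₀ : (EuclideanSpace ℝ (Fin 3)), eLpNorm (fun x => P x - c x₀) ((3 / 2 : ℝ≥0) : ℝ≥0∞)
      (volume.restrict (ball x₀ (3 * (18 * R)))) ≤ ENNReal.ofReal (K_P * (1 + ‖x₀‖) ^ 2) := fun x₀ => by
    rw [← h54, coe_nnreal_three_halves]
    exact (eLpNorm_restrict_ball_mono _ _ x₀ (by linarith)).trans (hPc' x₀)
  have h1le : (1 : ℝ≥0) ≤ 3 / 2 := by
    rw [le_div_iff₀ (two_pos : (0 : ℝ≥0) < 2)]; norm_num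
  obtain ⟨K₆, hK₆, hS5a⟩ := exists_poly_bound_gns_fderiv hU (p := 3 / 2) (p' := 3) h1le hp32.symm
    (by positivity : 0 < 18 * R) hK₅ hK₃ hD2U hDU54
  obtain ⟨K₇, hK₇, hS5b⟩ := exists_poly_bound_gns_pressure hP1 (p := 3 / 2) (p' := 3) h1le hp32.symm
    (by positivity : 0 < 18 * R) hK₅ hK_P hDP hP54
  -- collect
  refine ⟨max (max K₁ K₂) (max K₆ K₇), by positivity, fun x₀ => ⟨?_, ?_, ?_, ?_⟩⟩
  · exact (hS1' x₀).trans (ENNReal.ofReal_le_ofReal (by gcongr; exact (le_max_left _ _).trans (le_max_left _ _)))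
  · exact (hS2' x₀).trans (ENNReal.ofReal_le_ofReal (by gcongr; exact (le_max_right _ _).trans (le_max_left _ _)))
  · have := hS5a x₀
    refine (by exact_mod_cast this : eLpNorm (fun x => fderiv ℝ U x) 3 (volume.restrict (ball x₀ (18 * R))) ≤
      ENNReal.ofReal (K₆ * (1 + ‖x₀‖) ^ 2)).trans (ENNReal.ofReal_le_ofReal ?_)
    gcongr; exact (le_max_left _ _).trans (le_max_right _ _)
  · have := hS5b x₀
    refine (by exact_mod_cast this : eLpNorm (fun x => P x - c x₀) 3 (volume.restrict (ball x₀ (18 * R))) ≤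
      ENNReal.ofReal (K₇ * (1 + ‖x₀‖) ^ 2)).trans (ENNReal.ofReal_le_ofReal ?_)
    gcongr; exact (le_max_right _ _).trans (le_max_right _ _)

/-- Lowering the exponent under a polynomial bound, for a family of functions indexed by the centre
(such as `P − c_{x₀}`). [folklore] -/
theorem exists_poly_bound_of_exponent_le' {G : Type*} [NormedAddCommGroup G] {f : (EuclideanSpace ℝ (Fin 3)) → (EuclideanSpace ℝ (Fin 3)) → G}
    (hf : ∀ x₀, AEStronglyMeasurable (f x₀) volume) {s s' : ℝ≥0∞} (hs1 : 1 ≤ s) (hss' : s ≤ s') (R : ℝ)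
    {K : ℝ} (hK : 0 ≤ K) {m : ℕ}
    (h : ∀ x₀ : (EuclideanSpace ℝ (Fin 3)), eLpNorm (f x₀) s' (volume.restrict (ball x₀ R)) ≤ ENNReal.ofReal (K * (1 + ‖x₀‖) ^ m)) :
    ∃ K' : ℝ, 0 ≤ K' ∧ ∀ x₀ : (EuclideanSpace ℝ (Fin 3)), eLpNorm (f x₀) s (volume.restrict (ball x₀ R)) ≤
      ENNReal.ofReal (K' * (1 + ‖x₀‖) ^ m) := by
  set V : ℝ≥0∞ := (volume (ball (0 : (EuclideanSpace ℝ (Fin 3))) R)) ^ (1 / s.toReal - 1 / s'.toReal) with hV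
  have hVlt : V < ⊤ := volume_ball_rpow_lt_top R (one_div_toReal_sub_nonneg hs1 hss')
  refine ⟨V.toReal * K, by positivity, fun x₀ => ?_⟩
  calc eLpNorm (f x₀) s (volume.restrict (ball x₀ R))
      ≤ eLpNorm (f x₀) s' (volume.restrict (ball x₀ R)) * V := eLpNorm_ball_le_mul_eLpNorm (hf x₀) hss' x₀ R
    _ ≤ ENNReal.ofReal (K * (1 + ‖x₀‖) ^ m) * V := by gcongr; exact h x₀
    _ = ENNReal.ofReal ((V.toReal * K) * (1 + ‖x₀‖) ^ m) := by
        rw [mul_comm, const_mul_ofReal_poly hVlt.ne]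

/-- The exponent `12/5` and its Sobolev conjugate `12`. [folklore] -/
theorem twelve_fifths_facts :
    (1 : ℝ≥0) ≤ 12 / 5 ∧ (((12 / 5 : ℝ≥0)) : ℝ≥0∞) ≤ 3 ∧ (((12 / 5 : ℝ≥0)) : ℝ≥0∞) ≤ 6 ∧
      ((12 : ℝ≥0) : ℝ)⁻¹ = ((12 / 5 : ℝ≥0) : ℝ)⁻¹ - 3⁻¹ := by
  have hc : (((12 / 5 : ℝ≥0)) : ℝ≥0∞) = ENNReal.ofReal (12 / 5) := by
    rw [ENNReal.ofReal_div_of_pos (by norm_num : (0 : ℝ) < 5), ENNReal.coe_div (by norm_num),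
      ENNReal.coe_ofNat, ENNReal.coe_ofNat, ENNReal.ofReal_ofNat, ENNReal.ofReal_ofNat]
  refine ⟨?_, ?_, ?_, ?_⟩
  · rw [le_div_iff₀ (by norm_num : (0 : ℝ≥0) < 5)]; norm_num
  · rw [hc, ← ENNReal.ofReal_ofNat]; exact ENNReal.ofReal_le_ofReal (by norm_num)
  · rw [hc, ← ENNReal.ofReal_ofNat]; exact ENNReal.ofReal_le_ofReal (by norm_num)
  · push_cast; norm_num

/-- **The bootstrap (Tsai 1998, §3.2), both rounds.** For a Leray profile `(U, P)` on `(EuclideanSpace ℝ (Fin 3))` with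
`U ∈ C^∞ ∩ L^q((EuclideanSpace ℝ (Fin 3)))`, `3 ≤ q ≤ ∞`, `ν > 0`, `a ≥ 0`, the interior Stokes estimate
(`stokes_interior_Lr_estimate`) and a local pressure control
`‖P − c_{x₀}‖_{L^{3/2}(B(x₀,1000R))} ≤ K_P (1 + |x₀|)`, the local norms
`‖DU‖_{L²(B(x₀,9R))}`, `‖U‖_{L⁶(B(x₀,9R))}`, `‖D²U‖_{L²(B(x₀,9R))}`, `‖DU‖_{L⁶(B(x₀,3R))}` and
`‖U‖_{L^{12}(B(x₀,R))}` are all bounded by `K (1 + |x₀|)³`, uniformly in the centre `x₀`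
(Tsai: `o(|y₀|²)` for `‖∇²U‖_{2,B_{1/4}}`, `‖∇U‖_{6,B_{1/4}}`, and `osc U` by Morrey; here the sup
bound on `U` is replaced by an `L^{12}` bound via GNS with `p = 12/5`).
[cite: Tsai1998, §3.2 (pp. 38–39)] -/
theorem IsLerayProfile.bootstrap (hSt : stokes_interior_Lr_estimate)
    (hprof : IsLerayProfile ν a U P) (hU : ContDiff ℝ ∞ U) (hν : 0 < ν) (ha : 0 ≤ a) {q : ℝ≥0∞}
    (hq : 3 ≤ q) (hUq : MemLp U q volume) {R : ℝ} (hR : 0 < R) {c : (EuclideanSpace ℝ (Fin 3)) → ℝ} {K_P : ℝ} (hK_P : 0 ≤ K_P)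
    (hPc : ∀ x₀ : (EuclideanSpace ℝ (Fin 3)), eLpNorm (fun x => P x - c x₀) (ENNReal.ofReal (3 / 2))
      (volume.restrict (ball x₀ (1000 * R))) ≤ ENNReal.ofReal (K_P * (1 + ‖x₀‖))) :
    ∃ K : ℝ, 0 ≤ K ∧ ∀ x₀ : (EuclideanSpace ℝ (Fin 3)),
      eLpNorm (fun x => fderiv ℝ U x) 2 (volume.restrict (ball x₀ (9 * R))) ≤ ENNReal.ofReal (K * (1 + ‖x₀‖) ^ 3) ∧
      eLpNorm U 6 (volume.restrict (ball x₀ (9 * R))) ≤ ENNReal.ofReal (K * (1 + ‖x₀‖) ^ 3) ∧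
      eLpNorm (fun x => iteratedFDeriv ℝ 2 U x) 2 (volume.restrict (ball x₀ (9 * R))) ≤
          ENNReal.ofReal (K * (1 + ‖x₀‖) ^ 3) ∧
      eLpNorm (fun x => fderiv ℝ U x) 6 (volume.restrict (ball x₀ (3 * R))) ≤ ENNReal.ofReal (K * (1 + ‖x₀‖) ^ 3) ∧
      eLpNorm U 12 (volume.restrict (ball x₀ R)) ≤ ENNReal.ofReal (K * (1 + ‖x₀‖) ^ 3) := by
  have hUc : Continuous U := hU.continuous
  have hU1 : ContDiff ℝ 1 U := hU.of_le (by norm_cast)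
  have hP1 : ContDiff ℝ 1 P := (hprof.contDiff_two_pressure (hU.of_le (by norm_cast))).of_le one_le_two
  have hDUc : Continuous fun x => fderiv ℝ U x := hU1.continuous_fderiv one_ne_zero
  obtain ⟨K₀, hK₀, hround⟩ := hprof.bootstrap_round_one hSt hU hν ha hq hUq hR hK_P hPc
  -- uniform `U ∈ L²(18R)`, `U ∈ L^{12/5}(3R)`
  obtain ⟨h125a, h125b, h125c, h125d⟩ := twelve_fifths_facts
  obtain ⟨CU2, hCU20, hCU2⟩ := exists_eLpNorm_restrict_ball_le_of_memLp hUc hUq (s := 2) (by norm_num)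
    (le_trans (by norm_num) hq) (18 * R)
  obtain ⟨CU125, hCU1250, hCU125⟩ := exists_eLpNorm_restrict_ball_le_of_memLp hUc hUq
    (s := ((12 / 5 : ℝ≥0) : ℝ≥0∞)) (by exact_mod_cast h125a) (h125b.trans hq) (3 * R)
  -- degree-3 forms on `B(x₀, 18R)` of the round-one bounds
  have ht0 : ∀ x₀ : (EuclideanSpace ℝ (Fin 3)), 0 ≤ ‖x₀‖ := fun x₀ => norm_nonneg _
  have hDU2 : ∀ x₀ : (EuclideanSpace ℝ (Fin 3)), eLpNorm (fun x => fderiv ℝ U x) 2 (volume.restrict (ball x₀ (18 * R))) ≤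
      ENNReal.ofReal (K₀ * (1 + ‖x₀‖) ^ 1) := fun x₀ =>
    (eLpNorm_restrict_ball_mono _ _ x₀ (by linarith)).trans (hround x₀).1
  have hU6 : ∀ x₀ : (EuclideanSpace ℝ (Fin 3)), eLpNorm U 6 (volume.restrict (ball x₀ (18 * R))) ≤ ENNReal.ofReal (K₀ * (1 + ‖x₀‖) ^ 1) :=
    fun x₀ => (eLpNorm_restrict_ball_mono _ _ x₀ (by linarith)).trans (hround x₀).2.1
  have hDU3 : ∀ x₀ : (EuclideanSpace ℝ (Fin 3)), eLpNorm (fun x => fderiv ℝ U x) 3 (volume.restrict (ball x₀ (18 * R))) ≤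
      ENNReal.ofReal (K₀ * (1 + ‖x₀‖) ^ 2) := fun x₀ => (hround x₀).2.2.1
  have hP3 : ∀ x₀ : (EuclideanSpace ℝ (Fin 3)), eLpNorm (fun x => P x - c x₀) 3 (volume.restrict (ball x₀ (18 * R))) ≤
      ENNReal.ofReal (K₀ * (1 + ‖x₀‖) ^ 2) := fun x₀ => (hround x₀).2.2.2
  -- S6: `F ∈ L²(18R)`, degree 3
  haveI : ENNReal.HolderTriple 3 6 2 := ENNReal.HolderTriple.of_toReal (by norm_num [Real.holderTriple_iff])
  obtain ⟨K₁, hK₁, hS6⟩ := exists_poly_bound_bodyForce a hU1 (by positivity : 0 < 18 * R) (le_refl (1 : ℝ≥0∞) |>.trans one_le_two)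
    (p := 2) (q₁ := 3) (q₂ := 6) hCU20 hK₀ hK₀ hK₀ (poly_zero_of_uniform hCU2 0 hCU20) hDU2 hDU3 hU6
  have hdeg6 : max (max 0 (1 + 1)) (2 + 1) = 3 := by norm_num
  rw [hdeg6] at hS6
  -- S7: Stokes at `r = 2`, `S = 9R`
  have h18 : (18 : ℝ) * R = 2 * (9 * R) := by ring
  obtain ⟨KP2, hKP2, hP2⟩ := exists_poly_bound_of_exponent_le' (f := fun x₀ x => P x - c x₀)
    (fun x₀ => (hP1.continuous.sub continuous_const).aestronglyMeasurable) (s := 2) (s' := 3)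
    (by norm_num) (by norm_num) (18 * R) hK₀ hP3
  have hF2 : ∀ x₀ : (EuclideanSpace ℝ (Fin 3)), eLpNorm (fun x => a • U x + a • fderiv ℝ U x x + convect U U x) 2
      (volume.restrict (ball x₀ (2 * (9 * R)))) ≤ ENNReal.ofReal (K₁ * (1 + ‖x₀‖) ^ 3) := fun x₀ => by
    rw [← h18]; exact hS6 x₀
  have hU2' : ∀ x₀ : (EuclideanSpace ℝ (Fin 3)), eLpNorm U 2 (volume.restrict (ball x₀ (2 * (9 * R)))) ≤ ENNReal.ofReal (CU2 * (1 + ‖x₀‖) ^ 3) :=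
    fun x₀ => by rw [← h18]; exact poly_zero_of_uniform hCU2 3 hCU20 x₀
  have hDU2' : ∀ x₀ : (EuclideanSpace ℝ (Fin 3)), eLpNorm (fun x => fderiv ℝ U x) 2 (volume.restrict (ball x₀ (2 * (9 * R)))) ≤
      ENNReal.ofReal (K₀ * (1 + ‖x₀‖) ^ 3) := fun x₀ => by
    rw [← h18]; exact (hDU2 x₀).trans (ofReal_poly_le_of_le hK₀ (ht0 x₀) (by norm_num))
  have hP2' : ∀ x₀ : (EuclideanSpace ℝ (Fin 3)), eLpNorm (fun x => P x - c x₀) 2 (volume.restrict (ball x₀ (2 * (9 * R)))) ≤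
      ENNReal.ofReal (KP2 * (1 + ‖x₀‖) ^ 3) := fun x₀ => by
    rw [← h18]; exact (hP2 x₀).trans (ofReal_poly_le_of_le hKP2 (ht0 x₀) (by norm_num))
  obtain ⟨K₂, hK₂, hS7⟩ := hprof.exists_poly_bound_stokes hSt hU hν (r := 2) (by norm_num) (by norm_num)
    (by positivity : 0 < 9 * R) hK₁ hCU20 hK₀ hKP2 hF2 hU2' hDU2' hP2'
  -- S8: Sobolev `2 → 6` at `s = 3R`
  have h9 : (9 : ℝ) * R = 3 * (3 * R) := by ring
  have hD2U : ∀ x₀ : (EuclideanSpace ℝ (Fin 3)), eLpNorm (fun x => iteratedFDeriv ℝ 2 U x) ((2 : ℝ≥0) : ℝ≥0∞)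
      (volume.restrict (ball x₀ (3 * (3 * R)))) ≤ ENNReal.ofReal (K₂ * (1 + ‖x₀‖) ^ 3) := fun x₀ => by
    rw [← h9]; exact_mod_cast (hS7 x₀).1
  have hDU9 : ∀ x₀ : (EuclideanSpace ℝ (Fin 3)), eLpNorm (fun x => fderiv ℝ U x) ((2 : ℝ≥0) : ℝ≥0∞)
      (volume.restrict (ball x₀ (3 * (3 * R)))) ≤ ENNReal.ofReal (K₀ * (1 + ‖x₀‖) ^ 3) := fun x₀ => by
    rw [← h9]
    have h := (eLpNorm_restrict_ball_mono (fun x => fderiv ℝ U x) 2 x₀ (by linarith : 9 * R ≤ 18 * R)).trans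
      ((hDU2 x₀).trans (ofReal_poly_le_of_le hK₀ (ht0 x₀) (by norm_num : 1 ≤ 3)))
    exact_mod_cast h
  obtain ⟨K₃, hK₃, hS8⟩ := exists_poly_bound_gns_fderiv hU (p := 2) (p' := 6) (by norm_num) (by norm_num)
    (by positivity : 0 < 3 * R) hK₂ hK₀ hD2U hDU9
  have hS8' : ∀ x₀ : (EuclideanSpace ℝ (Fin 3)), eLpNorm (fun x => fderiv ℝ U x) 6 (volume.restrict (ball x₀ (3 * R))) ≤
      ENNReal.ofReal (K₃ * (1 + ‖x₀‖) ^ 3) := fun x₀ => by exact_mod_cast hS8 x₀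
  -- S9: Sobolev `12/5 → 12` at `s = R`
  obtain ⟨K₄, hK₄, hDU125⟩ := exists_poly_bound_of_exponent_le hDUc (s := ((12 / 5 : ℝ≥0) : ℝ≥0∞)) (s' := 6)
    (by exact_mod_cast h125a) h125c (3 * R) hK₃ hS8'
  obtain ⟨K₅, hK₅, hS9⟩ := exists_poly_bound_of_gns hU1 (p := 12 / 5) (p' := 12) h125a h125d hR hK₄ hCU1250
    hDU125 (poly_zero_of_uniform hCU125 3 hCU1250)
  have hS9' : ∀ x₀ : (EuclideanSpace ℝ (Fin 3)), eLpNorm U 12 (volume.restrict (ball x₀ R)) ≤ ENNReal.ofReal (K₅ * (1 + ‖x₀‖) ^ 3) :=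
    fun x₀ => by exact_mod_cast hS9 x₀
  -- collect
  set K : ℝ := max (max K₀ K₂) (max K₃ K₅) with hKdef
  have hK0K : K₀ ≤ K := (le_max_left _ _).trans (le_max_left _ _)
  have hK2K : K₂ ≤ K := (le_max_right _ _).trans (le_max_left _ _)
  have hK3K : K₃ ≤ K := (le_max_left _ _).trans (le_max_right _ _)
  have hK5K : K₅ ≤ K := (le_max_right _ _).trans (le_max_right _ _)
  refine ⟨K, hK₀.trans hK0K, fun x₀ => ⟨?_, ?_, ?_, ?_, ?_⟩⟩
  · refine ((eLpNorm_restrict_ball_mono _ _ x₀ (by linarith)).trans (hDU2 x₀)).trans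
      ((ofReal_poly_le_of_le hK₀ (ht0 x₀) (by norm_num : 1 ≤ 3)).trans (ENNReal.ofReal_le_ofReal ?_))
    gcongr
  · refine ((eLpNorm_restrict_ball_mono _ _ x₀ (by linarith)).trans (hU6 x₀)).trans
      ((ofReal_poly_le_of_le hK₀ (ht0 x₀) (by norm_num : 1 ≤ 3)).trans (ENNReal.ofReal_le_ofReal ?_))
    gcongr
  · exact (hS7 x₀).1.trans (ENNReal.ofReal_le_ofReal (by gcongr))
  · exact (hS8' x₀).trans (ENNReal.ofReal_le_ofReal (by gcongr))
  · exact (hS9' x₀).trans (ENNReal.ofReal_le_ofReal (by gcongr))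

end Bootstrap

end Literature.Analysis.FluidPDE

end
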